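import Mathlib
import Summits.MatrixMultiplication.MatrixMultiplication.Theorems.LieRankDesigns.Negative.Basics
import Summits.MatrixMultiplication.MatrixMultiplication.Theorems.LevelGradedCohnUmansLieRankDesignsStubSharpLevelDegree

/-!
# Stub `stub_upperPiece` (line `levi-free-rigid-outer-pieces`, crux `SubgroupIdentityDesigns`, stmt-MatrixMultiplication-14079)

Crux `Summit.MatrixMultiplication.MatrixMultiplication.Theses.LevelGradedCohnUmans.SubgroupIdentityDesigns`, line
`levi-free-rigid-outer-pieces` (skeleton `Cruxes/SubgroupIdentityDesigns/Lines/levi-free-rigid-outer-pieces.lean`);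
this file proves the registered stub `stub_upperPiece` verbatim and lands
`--supports stmt-MatrixMultiplication-14079`.

Content (folklore bookkeeping, Mathlib only).  `G = GL_{k+r}(𝔽_p)`; the first `k` rows/columns are
`Fin.castAdd r i`, the last `r` ("Levi") ones are `Fin.natAdd k j`.  For a subgroup `T ≤ GL_r(𝔽_p)` the
UPPER RIGID PIECE of `T` is the set of block matrices `g = [[u, Z], [0, t]]` with `u` an upper unitriangular
`k × k` block (`g_ii = 1`, zero below the diagonal), bottom-left `r × k` block `0`, top-right block `Z`
arbitrary and bottom-right block `= t ∈ T`.
* It is (the carrier of) a subgroup (`upper_one`, `upper_mul`): the predicate holds at `1` and is closed under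
  products — `[[u,Z],[0,t]]·[[u',Z'],[0,t']] = [[uu', uZ'+Zt'],[0, tt']]`, entrywise after splitting
  `Σ_{Fin (k+r)}` by `Fin.sum_univ_add` — and a product-closed subset of a finite group containing `1` is a
  subgroup (tree: `LieRankDesigns.SharpLevelDegree.exists_subgroup_of_mul_mem`, imported).
* Any subgroup with this carrier has order `p^{C(k,2) + r k} · |T|` (`card_upper`): the block matrix
  `[[u, Z], [0, t]]` assembled from the strictly-upper entries of `u`, from `Z` and from `t` (`exists_upMat`:
  `Matrix.fromBlocks` transported along `finSumFinEquiv`; `det = det u · det t = det t` is a unit) parametrises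
  it bijectively by `((j : Fin k) → Fin j → 𝔽_p) × (Fin k → Fin r → 𝔽_p) × T`, a type with
  `p^{Σ_{j<k} j} · p^{r k} · |T|` elements (`card_data`), and `Σ_{j<k} j = C(k,2)`.
-/

set_option linter.dupNamespace false

noncomputable section

open scoped BigOperators
open Summit.MatrixMultiplication.MatrixMultiplication.Theorems.LieRankDesigns.Negative (GLm Mat)

namespace Summit.MatrixMultiplication.MatrixMultiplication.Theorems.LeviFreeRigidOuterPieces

namespace UpperPiece

variable {p k r : ℕ}

/-! ### Block calculus on `Fin (k + r)` -/

/-- A Levi index `k + i` is never one of the first `k` indices. -/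
theorem natAdd_ne_castAdd (i : Fin r) (j : Fin k) : Fin.natAdd k i ≠ Fin.castAdd r j := by
  intro h
  have h' : k + (i : ℕ) = (j : ℕ) := congrArg Fin.val h
  have hj : (j : ℕ) < k := j.isLt
  omega

/-- An entry of a product of two matrices, the sum split along `Fin (k + r) = Fin k ⊔ Fin r`. -/
theorem mul_apply_split (x y : Mat p (k + r)) (a b : Fin (k + r)) :
    (x * y) a b = ∑ l : Fin k, x a (Fin.castAdd r l) * y (Fin.castAdd r l) b +
      ∑ l : Fin r, x a (Fin.natAdd k l) * y (Fin.natAdd k l) b := by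
  rw [Matrix.mul_apply, Fin.sum_univ_add]

/-! ### The upper piece contains `1` and is closed under products -/

/-- `1 ∈ GL_{k+r}(𝔽_p)` has the upper-piece shape `[[u, Z], [0, t]]` (with `u = 1`, `Z = 0`, `t = 1 ∈ T`). -/
theorem upper_one (T : Subgroup (GLm p r)) :
    (∀ (i : Fin r) (j : Fin k), ((1 : GLm p (k + r)) : Mat p (k + r)) (Fin.natAdd k i) (Fin.castAdd r j) = 0) ∧
      (∀ i : Fin k, ((1 : GLm p (k + r)) : Mat p (k + r)) (Fin.castAdd r i) (Fin.castAdd r i) = 1) ∧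
      (∀ i j : Fin k, j < i →
        ((1 : GLm p (k + r)) : Mat p (k + r)) (Fin.castAdd r i) (Fin.castAdd r j) = 0) ∧
      (∃ t ∈ T, ∀ i j : Fin r, ((1 : GLm p (k + r)) : Mat p (k + r)) (Fin.natAdd k i) (Fin.natAdd k j) =
        (t : Mat p r) i j) := by
  refine ⟨fun i j => ?_, fun i => ?_, fun i j hij => ?_, ⟨1, T.one_mem, fun i j => ?_⟩⟩
  · rw [Units.val_one]
    exact Matrix.one_apply_ne (natAdd_ne_castAdd i j)
  · rw [Units.val_one]
    exact Matrix.one_apply_eq _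
  · rw [Units.val_one]
    exact Matrix.one_apply_ne fun h => hij.ne' (Fin.castAdd_inj.mp h)
  · rw [Units.val_one, Units.val_one]
    by_cases h : i = j
    · rw [h, Matrix.one_apply_eq, Matrix.one_apply_eq]
    · rw [Matrix.one_apply_ne h, Matrix.one_apply_ne fun h' => h ((Fin.natAdd_inj k).mp h')]

/-- The upper-piece shape is closed under products:
`[[u, Z], [0, t]] · [[u', Z'], [0, t']] = [[u u', u Z' + Z t'], [0, t t']]`. -/
theorem upper_mul (T : Subgroup (GLm p r)) {a b : GLm p (k + r)}
    (ha : (∀ (i : Fin r) (j : Fin k), (a : Mat p (k + r)) (Fin.natAdd k i) (Fin.castAdd r j) = 0) ∧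
      (∀ i : Fin k, (a : Mat p (k + r)) (Fin.castAdd r i) (Fin.castAdd r i) = 1) ∧
      (∀ i j : Fin k, j < i → (a : Mat p (k + r)) (Fin.castAdd r i) (Fin.castAdd r j) = 0) ∧
      (∃ t ∈ T, ∀ i j : Fin r, (a : Mat p (k + r)) (Fin.natAdd k i) (Fin.natAdd k j) = (t : Mat p r) i j))
    (hb : (∀ (i : Fin r) (j : Fin k), (b : Mat p (k + r)) (Fin.natAdd k i) (Fin.castAdd r j) = 0) ∧
      (∀ i : Fin k, (b : Mat p (k + r)) (Fin.castAdd r i) (Fin.castAdd r i) = 1) ∧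
      (∀ i j : Fin k, j < i → (b : Mat p (k + r)) (Fin.castAdd r i) (Fin.castAdd r j) = 0) ∧
      (∃ t ∈ T, ∀ i j : Fin r, (b : Mat p (k + r)) (Fin.natAdd k i) (Fin.natAdd k j) = (t : Mat p r) i j)) :
    (∀ (i : Fin r) (j : Fin k),
        ((a * b : GLm p (k + r)) : Mat p (k + r)) (Fin.natAdd k i) (Fin.castAdd r j) = 0) ∧
      (∀ i : Fin k, ((a * b : GLm p (k + r)) : Mat p (k + r)) (Fin.castAdd r i) (Fin.castAdd r i) = 1) ∧
      (∀ i j : Fin k, j < i →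
        ((a * b : GLm p (k + r)) : Mat p (k + r)) (Fin.castAdd r i) (Fin.castAdd r j) = 0) ∧
      (∃ t ∈ T, ∀ i j : Fin r,
        ((a * b : GLm p (k + r)) : Mat p (k + r)) (Fin.natAdd k i) (Fin.natAdd k j) = (t : Mat p r) i j) := by
  obtain ⟨ha1, ha2, ha3, ta, hta, ha4⟩ := ha
  obtain ⟨hb1, hb2, hb3, tb, htb, hb4⟩ := hb
  refine ⟨fun i j => ?_, fun i => ?_, fun i j hij => ?_, ⟨ta * tb, T.mul_mem hta htb, fun i j => ?_⟩⟩
  · -- bottom-left block: `0 · u' + t · 0 = 0`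
    rw [Units.val_mul, mul_apply_split]
    have h1 : ∑ l : Fin k, (a : Mat p (k + r)) (Fin.natAdd k i) (Fin.castAdd r l) *
        (b : Mat p (k + r)) (Fin.castAdd r l) (Fin.castAdd r j) = 0 :=
      Finset.sum_eq_zero fun l _ => by rw [ha1 i l, zero_mul]
    have h2 : ∑ l : Fin r, (a : Mat p (k + r)) (Fin.natAdd k i) (Fin.natAdd k l) *
        (b : Mat p (k + r)) (Fin.natAdd k l) (Fin.castAdd r j) = 0 :=
      Finset.sum_eq_zero fun l _ => by rw [hb1 l j, mul_zero]
    rw [h1, h2, add_zero]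
  · -- diagonal of `u u'`
    rw [Units.val_mul, mul_apply_split]
    have h1 : ∑ l : Fin k, (a : Mat p (k + r)) (Fin.castAdd r i) (Fin.castAdd r l) *
        (b : Mat p (k + r)) (Fin.castAdd r l) (Fin.castAdd r i) = 1 := by
      rw [Finset.sum_eq_single_of_mem i (Finset.mem_univ i), ha2 i, hb2 i, mul_one]
      intro l _ hl
      rcases lt_or_gt_of_ne hl with h | h
      · rw [ha3 i l h, zero_mul]
      · rw [hb3 l i h, mul_zero]
    have h2 : ∑ l : Fin r, (a : Mat p (k + r)) (Fin.castAdd r i) (Fin.natAdd k l) *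
        (b : Mat p (k + r)) (Fin.natAdd k l) (Fin.castAdd r i) = 0 :=
      Finset.sum_eq_zero fun l _ => by rw [hb1 l i, mul_zero]
    rw [h1, h2, add_zero]
  · -- below the diagonal of `u u'`
    rw [Units.val_mul, mul_apply_split]
    have h1 : ∑ l : Fin k, (a : Mat p (k + r)) (Fin.castAdd r i) (Fin.castAdd r l) *
        (b : Mat p (k + r)) (Fin.castAdd r l) (Fin.castAdd r j) = 0 := by
      refine Finset.sum_eq_zero fun l _ => ?_
      rcases lt_or_ge l i with h | h
      · rw [ha3 i l h, zero_mul]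
      · rw [hb3 l j (lt_of_lt_of_le hij h), mul_zero]
    have h2 : ∑ l : Fin r, (a : Mat p (k + r)) (Fin.castAdd r i) (Fin.natAdd k l) *
        (b : Mat p (k + r)) (Fin.natAdd k l) (Fin.castAdd r j) = 0 :=
      Finset.sum_eq_zero fun l _ => by rw [hb1 l j, mul_zero]
    rw [h1, h2, add_zero]
  · -- Levi block: `0 · Z' + t · t' = t t'`
    rw [Units.val_mul, mul_apply_split, Units.val_mul, Matrix.mul_apply]
    have h1 : ∑ l : Fin k, (a : Mat p (k + r)) (Fin.natAdd k i) (Fin.castAdd r l) *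
        (b : Mat p (k + r)) (Fin.castAdd r l) (Fin.natAdd k j) = 0 :=
      Finset.sum_eq_zero fun l _ => by rw [ha1 i l, zero_mul]
    rw [h1, zero_add]
    exact Finset.sum_congr rfl fun l _ => by rw [ha4 i l, hb4 l j]

/-! ### The block matrix `[[u, Z], [0, t]]` and the parameter count -/

/-- The upper unitriangular `k × k` block with prescribed strictly-upper entries `e` (entry `(i, j)`, `i < j`,
is `e j ⟨i, _⟩`): a builder `U`, its entries, and `det (U e) = 1`. [folklore] -/
theorem exists_uBlock (p k : ℕ) :
    ∃ U : ((j : Fin k) → Fin (j : ℕ) → ZMod p) → Matrix (Fin k) (Fin k) (ZMod p),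
      (∀ e i, U e i i = 1) ∧ (∀ e (i j : Fin k), j < i → U e i j = 0) ∧
      (∀ e (i j : Fin k) (h : (i : ℕ) < j), U e i j = e j ⟨i, h⟩) ∧ (∀ e, (U e).det = 1) := by
  obtain ⟨U, hU1, hU2, hU3⟩ :
      ∃ U : ((j : Fin k) → Fin (j : ℕ) → ZMod p) → Matrix (Fin k) (Fin k) (ZMod p),
        (∀ e i, U e i i = 1) ∧ (∀ e (i j : Fin k), j < i → U e i j = 0) ∧
        (∀ e (i j : Fin k) (h : (i : ℕ) < j), U e i j = e j ⟨i, h⟩) := by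
    refine ⟨fun e => Matrix.of fun i j => if h : (i : ℕ) < j then e j ⟨i, h⟩ else if i = j then 1 else 0,
      fun e i => ?_, fun e i j hij => ?_, fun e i j h => ?_⟩
    · beta_reduce
      rw [Matrix.of_apply, dif_neg (lt_irrefl _), if_pos rfl]
    · beta_reduce
      rw [Matrix.of_apply, dif_neg (not_lt.mpr (Fin.le_def.mp hij.le)), if_neg hij.ne']
    · beta_reduce
      rw [Matrix.of_apply, dif_pos h]
  refine ⟨U, hU1, hU2, hU3, fun e => ?_⟩
  rw [Matrix.det_of_upperTriangular (M := U e) fun i j hij => hU2 e i j hij,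
    Finset.prod_eq_one fun i _ => hU1 e i]

/-- A builder `M e Z t = [[u, Z], [0, t]]` of matrices on `Fin (k + r)` (`u` the upper unitriangular block of
strictly-upper entries `e`): its four blocks of entries and its determinant `det t`. [folklore] -/
theorem exists_upMat (p k r : ℕ) :
    ∃ M : ((j : Fin k) → Fin (j : ℕ) → ZMod p) → (Fin k → Fin r → ZMod p) → Mat p r → Mat p (k + r),
      (∀ e Z t (i : Fin k), M e Z t (Fin.castAdd r i) (Fin.castAdd r i) = 1) ∧
      (∀ e Z t (i j : Fin k), j < i → M e Z t (Fin.castAdd r i) (Fin.castAdd r j) = 0) ∧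
      (∀ e Z t (i j : Fin k) (h : (i : ℕ) < j), M e Z t (Fin.castAdd r i) (Fin.castAdd r j) = e j ⟨i, h⟩) ∧
      (∀ e Z t (i : Fin k) (j : Fin r), M e Z t (Fin.castAdd r i) (Fin.natAdd k j) = Z i j) ∧
      (∀ e Z t (i : Fin r) (j : Fin k), M e Z t (Fin.natAdd k i) (Fin.castAdd r j) = 0) ∧
      (∀ e Z t (i j : Fin r), M e Z t (Fin.natAdd k i) (Fin.natAdd k j) = t i j) ∧
      (∀ e Z t, (M e Z t).det = t.det) := by
  obtain ⟨U, hU1, hU2, hU3, hUdet⟩ := exists_uBlock p k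
  refine ⟨fun e Z t => Matrix.reindex finSumFinEquiv finSumFinEquiv (Matrix.fromBlocks (U e) (Matrix.of Z) 0 t),
    fun e Z t i => ?_, fun e Z t i j hij => ?_, fun e Z t i j h => ?_, fun e Z t i j => ?_,
    fun e Z t i j => ?_, fun e Z t i j => ?_, fun e Z t => ?_⟩
  · beta_reduce
    rw [Matrix.reindex_apply, Matrix.submatrix_apply, finSumFinEquiv_symm_apply_castAdd,
      Matrix.fromBlocks_apply₁₁, hU1]
  · beta_reduce
    rw [Matrix.reindex_apply, Matrix.submatrix_apply, finSumFinEquiv_symm_apply_castAdd,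
      finSumFinEquiv_symm_apply_castAdd, Matrix.fromBlocks_apply₁₁, hU2 e i j hij]
  · beta_reduce
    rw [Matrix.reindex_apply, Matrix.submatrix_apply, finSumFinEquiv_symm_apply_castAdd,
      finSumFinEquiv_symm_apply_castAdd, Matrix.fromBlocks_apply₁₁, hU3 e i j h]
  · beta_reduce
    rw [Matrix.reindex_apply, Matrix.submatrix_apply, finSumFinEquiv_symm_apply_castAdd,
      finSumFinEquiv_symm_apply_natAdd, Matrix.fromBlocks_apply₁₂, Matrix.of_apply]
  · beta_reduce
    rw [Matrix.reindex_apply, Matrix.submatrix_apply, finSumFinEquiv_symm_apply_natAdd,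
      finSumFinEquiv_symm_apply_castAdd, Matrix.fromBlocks_apply₂₁, Matrix.zero_apply]
  · beta_reduce
    rw [Matrix.reindex_apply, Matrix.submatrix_apply, finSumFinEquiv_symm_apply_natAdd,
      finSumFinEquiv_symm_apply_natAdd, Matrix.fromBlocks_apply₂₂]
  · beta_reduce
    rw [Matrix.det_reindex_self, Matrix.det_fromBlocks_zero₂₁, hUdet, one_mul]

/-- `p ^ C(k, 2)` choices for the strictly-upper entries: `Σ_{j<k} j = C(k, 2)`. -/
theorem card_strictUpper (p k : ℕ) : Nat.card ((j : Fin k) → Fin (j : ℕ) → ZMod p) = p ^ k.choose 2 := by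
  rw [Nat.card_pi]
  have h : ∀ j : Fin k, Nat.card (Fin (j : ℕ) → ZMod p) = p ^ (j : ℕ) := fun j => by
    rw [Nat.card_fun, Nat.card_zmod, Nat.card_fin]
  rw [Finset.prod_congr rfl fun j _ => h j, Finset.prod_pow_eq_pow_sum,
    Fin.sum_univ_eq_sum_range (fun i => i) k, Finset.sum_range_id, Nat.choose_two_right]

/-- The parameter type `((j : Fin k) → Fin j → 𝔽_p) × (Fin k → Fin r → 𝔽_p) × T` has
`p ^ (C(k,2) + r k) · |T|` elements. -/
theorem card_data (p k r : ℕ) (T : Subgroup (GLm p r)) :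
    Nat.card (((j : Fin k) → Fin (j : ℕ) → ZMod p) × (Fin k → Fin r → ZMod p) × T) =
      p ^ (k.choose 2 + r * k) * Nat.card T := by
  rw [Nat.card_prod, Nat.card_prod, card_strictUpper, Nat.card_fun, Nat.card_fun, Nat.card_zmod,
    Nat.card_fin, Nat.card_fin, ← pow_mul, pow_add, mul_assoc]

/-- **Order of the upper piece.**  Any subgroup of `GL_{k+r}(𝔽_p)` whose carrier is the upper rigid piece of
`T ≤ GL_r(𝔽_p)` has `p ^ (C(k,2) + r k) · |T|` elements: `(e, Z, t) ↦ [[u_e, Z], [0, t]]` is a bijection from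
the parameter type of `card_data` onto it. [folklore] -/
theorem card_upper (T : Subgroup (GLm p r)) (H : Subgroup (GLm p (k + r)))
    (hH : ∀ g : GLm p (k + r), g ∈ H ↔
      ((∀ (i : Fin (r)) (j : Fin (k)), (g : Mat p (k + r)) (Fin.natAdd (k) i) (Fin.castAdd (r) j) = 0) ∧
        (∀ i : Fin (k), (g : Mat p (k + r)) (Fin.castAdd (r) i) (Fin.castAdd (r) i) = 1) ∧
        (∀ i j : Fin (k), j < i → (g : Mat p (k + r)) (Fin.castAdd (r) i) (Fin.castAdd (r) j) = 0) ∧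
        (∃ t ∈ T, ∀ i j : Fin (r),
          (g : Mat p (k + r)) (Fin.natAdd (k) i) (Fin.natAdd (k) j) = (t : Mat p (r)) i j))) :
    Nat.card H = p ^ (k.choose 2 + r * k) * Nat.card T := by
  obtain ⟨M, hMa, hMb, hMc, hM12, hM21, hM22, hMdet⟩ := exists_upMat p k r
  -- the parametrisation `ψ (e, Z, t) = [[u_e, Z], [0, t]] ∈ H`
  obtain ⟨ψ, hψ⟩ : ∃ ψ : ((j : Fin k) → Fin (j : ℕ) → ZMod p) × (Fin k → Fin r → ZMod p) × T → H,
      ∀ d, ((ψ d : GLm p (k + r)) : Mat p (k + r)) = M d.1 d.2.1 ((d.2.2 : GLm p r) : Mat p r) := by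
    have hdet : ∀ d : ((j : Fin k) → Fin (j : ℕ) → ZMod p) × (Fin k → Fin r → ZMod p) × T,
        IsUnit (M d.1 d.2.1 ((d.2.2 : GLm p r) : Mat p r)).det := fun d => by
      rw [hMdet]
      exact Matrix.isUnits_det_units _
    have hmem : ∀ d : ((j : Fin k) → Fin (j : ℕ) → ZMod p) × (Fin k → Fin r → ZMod p) × T,
        Matrix.GeneralLinearGroup.mk'' _ (hdet d) ∈ H := fun d => by
      have hval : ((Matrix.GeneralLinearGroup.mk'' _ (hdet d) : GLm p (k + r)) : Mat p (k + r)) =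
          M d.1 d.2.1 ((d.2.2 : GLm p r) : Mat p r) := rfl
      rw [hH, hval]
      exact ⟨fun i j => hM21 _ _ _ i j, fun i => hMa _ _ _ i, fun i j hij => hMb _ _ _ i j hij,
        ⟨d.2.2, d.2.2.prop, fun i j => hM22 _ _ _ i j⟩⟩
    exact ⟨fun d => ⟨_, hmem d⟩, fun d => rfl⟩
  have hinj : Function.Injective ψ := by
    rintro ⟨e, Z, t⟩ ⟨e', Z', t'⟩ h
    have hm : M e Z ((t : GLm p r) : Mat p r) = M e' Z' ((t' : GLm p r) : Mat p r) := by
      have h' := congrArg (fun x : H => ((x : GLm p (k + r)) : Mat p (k + r))) h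
      simpa only [hψ] using h'
    have he : e = e' := by
      funext j i
      have hik : (i : ℕ) < k := lt_trans i.isLt j.isLt
      have h' := congrFun (congrFun hm (Fin.castAdd r ⟨i, hik⟩)) (Fin.castAdd r j)
      rwa [hMc e Z _ ⟨i, hik⟩ j i.isLt, hMc e' Z' _ ⟨i, hik⟩ j i.isLt] at h'
    have hZ : Z = Z' := by
      funext i j
      have h' := congrFun (congrFun hm (Fin.castAdd r i)) (Fin.natAdd k j)
      rwa [hM12, hM12] at h'
    have ht : t = t' := by
      refine Subtype.ext (Matrix.GeneralLinearGroup.ext fun i j => ?_)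
      have h' := congrFun (congrFun hm (Fin.natAdd k i)) (Fin.natAdd k j)
      rwa [hM22, hM22] at h'
    rw [he, hZ, ht]
  have hsurj : Function.Surjective ψ := by
    rintro ⟨g, hg⟩
    obtain ⟨h1, h2, h3, t, ht, h4⟩ := (hH g).mp hg
    refine ⟨⟨fun j i => (g : Mat p (k + r)) (Fin.castAdd r ⟨i, lt_trans i.isLt j.isLt⟩) (Fin.castAdd r j),
      fun i j => (g : Mat p (k + r)) (Fin.castAdd r i) (Fin.natAdd k j), ⟨t, ht⟩⟩,
      Subtype.ext (Matrix.GeneralLinearGroup.ext fun a b => ?_)⟩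
    rw [hψ]
    dsimp only
    cases a using Fin.addCases with
    | left i =>
      cases b using Fin.addCases with
      | left j =>
        rcases lt_trichotomy i j with hij | rfl | hij
        · exact hMc _ _ _ i j hij
        · rw [hMa, h2]
        · rw [hMb _ _ _ i j hij, h3 i j hij]
      | right j => rw [hM12]
    | right i =>
      cases b using Fin.addCases with
      | left j => rw [hM21, h1 i j]
      | right j => rw [hM22, h4 i j]
  rw [← Nat.card_eq_of_bijective ψ ⟨hinj, hsurj⟩, card_data]

end UpperPiece

/-- **Registered stub `stub_upperPiece`** (line `levi-free-rigid-outer-pieces`, crux `SubgroupIdentityDesigns`).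
For every prime `p`, all `k r : ℕ` and every subgroup `T ≤ GL_r(𝔽_p)`, the UPPER RIGID PIECE of `T` in
`GL_{k+r}(𝔽_p)` — the block matrices `[[u, Z], [0, t]]` with `u` upper unitriangular `k × k`, bottom-left
`r × k` block `0`, `Z` arbitrary and Levi block `t ∈ T` — is the carrier of a subgroup, and every subgroup with
this carrier has exactly `p ^ (C(k,2) + r k) · |T|` elements. [folklore] -/
theorem stub_upperPiece :
    ∀ (p k r : ℕ) [Fact p.Prime] (T : Subgroup (GLm p r)),
      (∃ H : Subgroup (GLm p (k + r)), ∀ g : GLm p (k + r), g ∈ H ↔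
        ((∀ (i : Fin (r)) (j : Fin (k)), (g : Mat p (k + r)) (Fin.natAdd (k) i) (Fin.castAdd (r) j) = 0) ∧
          (∀ i : Fin (k), (g : Mat p (k + r)) (Fin.castAdd (r) i) (Fin.castAdd (r) i) = 1) ∧
          (∀ i j : Fin (k), j < i → (g : Mat p (k + r)) (Fin.castAdd (r) i) (Fin.castAdd (r) j) = 0) ∧
          (∃ t ∈ T, ∀ i j : Fin (r), (g : Mat p (k + r)) (Fin.natAdd (k) i) (Fin.natAdd (k) j) = (t : Mat p (r)) i j))) ∧
      (∀ H : Subgroup (GLm p (k + r)), (∀ g : GLm p (k + r), g ∈ H ↔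
        ((∀ (i : Fin (r)) (j : Fin (k)), (g : Mat p (k + r)) (Fin.natAdd (k) i) (Fin.castAdd (r) j) = 0) ∧
          (∀ i : Fin (k), (g : Mat p (k + r)) (Fin.castAdd (r) i) (Fin.castAdd (r) i) = 1) ∧
          (∀ i j : Fin (k), j < i → (g : Mat p (k + r)) (Fin.castAdd (r) i) (Fin.castAdd (r) j) = 0) ∧
          (∃ t ∈ T, ∀ i j : Fin (r), (g : Mat p (k + r)) (Fin.natAdd (k) i) (Fin.natAdd (k) j) = (t : Mat p (r)) i j))) →
        Nat.card H = p ^ (k.choose 2 + r * k) * Nat.card T) := by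
  intro p k r _ T
  refine ⟨?_, fun H hH => UpperPiece.card_upper T H hH⟩
  exact Summit.MatrixMultiplication.MatrixMultiplication.Theorems.LieRankDesigns.SharpLevelDegree.exists_subgroup_of_mul_mem
    _ (UpperPiece.upper_one T) fun a b ha hb => UpperPiece.upper_mul T ha hb

end Summit.MatrixMultiplication.MatrixMultiplication.Theorems.LeviFreeRigidOuterPieces

end
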